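import Literature.MathematicalPhysics.QuantumManyBody.BoseGasDirichletMonotonicity
import HarnessLib

/-!
# A mixed Dirichlet/Neumann cell floor: one unconstrained Dirichlet group plus Neumann cells

Topic `Literature/MathematicalPhysics/QuantumManyBody`, namespace `…BoseGas`; companion of
`LiebYngvasonCellMethod.lean` (the Neumann cell method (2.52) of [LSSY2005], state-wise:
`sum_neumannGroundStateEnergy_mul_le_setLIntegral_cellSet`) and of
`BoseGasDirichletMonotonicity.lean` (the Dirichlet group extraction
`groundStateEnergy_mul_le_setLIntegral_group`).  Both mechanisms are combined here for a
`C¹` wave function `ψ` of `N` particles carrying a LABELLING `lam : Fin N → Fin (M + 1)`: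
the particles with the last label form the "bulk" group, which is only known to stay in a box
`Λ_L` (where `ψ` vanishes as soon as one of them leaves) and under whose permutations `ψ` is
symmetric; the particles with label `c < M` are confined to the open cell `corner c + Λ_ℓ`.

* `mixed_floor_le_setLIntegral` — on the region `R = {X | ∀ j, lam j = c < M → X j ∈ corner c + Λ_ℓ}`
  the energy density of `ψ` dominates
  `(E₀^D(n_bulk, L) + ∑_{c<M} E₀^Neu(n_c, ℓ)) · ∫_R |ψ|²`, `n_c = #{lam = c}`: group the kinetic
  energy by label, drop the interactions between different groups (`v ≥ 0`), extract the bulk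
  group with the DIRICHLET floor (it is unconstrained inside `R`, so no artificial boundary
  condition appears) and each cell group with the NEUMANN floor.
* `lintegral_eq_sum_setLIntegral_fiber` — for the grid cells of `Λ_{Kℓ}` (`corner = cellCorner K ℓ`,
  `M = K³`) and a fixed bulk/cell SPLIT `σ : Fin N → Fin 2` (`σ j = 0`: bulk), the regions of the
  labellings `lam` inducing `σ` partition configuration space up to a null set as far as functions
  vanishing off `Λ_{Kℓ}^N` are concerned: `∫ F = ∑_{lam ↦ σ} ∫_{R(lam)} F`.

These are the two halves of a localisation lower bound in which a smooth partition of unity decides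
the split `σ` (bulk versus a boundary layer) and the layer is then bracketed into Neumann cells.
No definitions. [LSSY2005, (2.52)–(2.53)]

## References

* [LSSY2005] E. H. Lieb, R. Seiringer, J. P. Solovej, J. Yngvason, *The Mathematics of the Bose
  Gas and its Condensation*, Oberwolfach Seminars 34, Birkhäuser 2005 (arXiv:cond-mat/0610117),
  (2.52)–(2.53) p. 16.
-/

noncomputable section

open MeasureTheory Filter Metric
open scoped ENNReal NNReal

namespace Literature.MathematicalPhysics.QuantumManyBody.BoseGas

variable {N M : ℕ}

/-! ### The mixed floor on the region of a labelling -/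

/-- A permutation of a label class, extended by the identity, preserves the labelling. [folklore] -/
theorem apply_extendDomain_eq_of_fiber (lam : Fin N → Fin (M + 1)) (c₀ : Fin (M + 1))
    (τ : Equiv.Perm (Fin (Finset.univ.filter fun i => lam i = c₀).card)) (j : Fin N) :
    lam ((τ.extendDomain (Equiv.ofInjective
      ((Finset.univ.filter fun i => lam i = c₀).orderEmbOfFin rfl)
      ((Finset.univ.filter fun i => lam i = c₀).orderEmbOfFin rfl).injective)) j) = lam j := by
  have hrange : ∀ j : Fin N,
      j ∈ Set.range ((Finset.univ.filter fun i => lam i = c₀).orderEmbOfFin rfl) ↔ lam j = c₀ := by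
    intro j
    rw [Finset.range_orderEmbOfFin]
    simp
  by_cases hj : j ∈ Set.range ((Finset.univ.filter fun i => lam i = c₀).orderEmbOfFin rfl)
  · have hj' := hj
    obtain ⟨i, rfl⟩ := hj
    have h : (τ.extendDomain (Equiv.ofInjective
        ((Finset.univ.filter fun i => lam i = c₀).orderEmbOfFin rfl)
        ((Finset.univ.filter fun i => lam i = c₀).orderEmbOfFin rfl).injective))
        ((Finset.univ.filter fun i => lam i = c₀).orderEmbOfFin rfl i) =
        (Finset.univ.filter fun i => lam i = c₀).orderEmbOfFin rfl (τ i) := by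
      simpa using Equiv.Perm.extendDomain_apply_image τ (Equiv.ofInjective
        ((Finset.univ.filter fun i => lam i = c₀).orderEmbOfFin rfl)
        ((Finset.univ.filter fun i => lam i = c₀).orderEmbOfFin rfl).injective) i
    rw [h, (hrange _).1 (Set.mem_range_self _), (hrange _).1 hj']
  · rw [Equiv.Perm.extendDomain_apply_not_subtype _ _ hj]

/-- The region of a labelling, seen from the bulk group (last label): no condition on the group,
the cell conditions on the others. [cite: LSSY2005, (2.52)] -/
theorem setOf_bulk_eq_region (lam : Fin N → Fin (M + 1)) (corner : Fin M → Space) (ℓ : ℝ) :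
    let ι := ((Finset.univ.filter fun i => lam i = Fin.last M).orderEmbOfFin rfl).toEmbedding
    {X : Config N | (fun j : {j // j ∉ Set.range ι} => X j) ∈
        {Z : {j // j ∉ Set.range ι} → Space |
          ∀ (j : {j // j ∉ Set.range ι}) (c : Fin M), lam j.1 = c.castSucc →
            Z j - corner c ∈ box ℓ}} =
      {X : Config N | ∀ j (c : Fin M), lam j = c.castSucc → X j - corner c ∈ box ℓ} := by
  intro ι
  have hrange : ∀ j : Fin N, j ∈ Set.range ι ↔ lam j = Fin.last M := by
    intro j
    change j ∈ Set.range ((Finset.univ.filter fun i => lam i = Fin.last M).orderEmbOfFin rfl) ↔ _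
    rw [Finset.range_orderEmbOfFin]
    simp
  ext X
  simp only [Set.mem_setOf_eq, Subtype.forall]
  constructor
  · intro h j c hjc
    have hj : j ∉ Set.range ι := fun hj => by
      rw [(hrange j).1 hj] at hjc
      exact (Fin.castSucc_lt_last c).ne' hjc
    exact h j hj c hjc
  · intro h j _ c hjc
    exact h j c hjc

/-- The region of a labelling, seen from the group of cell `c`: the group sits in the cell `c`,
the others satisfy the remaining cell conditions. [cite: LSSY2005, (2.52)] -/
theorem setOf_cell_eq_region (lam : Fin N → Fin (M + 1)) (corner : Fin M → Space) (ℓ : ℝ)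
    (c : Fin M) :
    let ι := ((Finset.univ.filter fun i => lam i = c.castSucc).orderEmbOfFin rfl).toEmbedding
    {X : Config N | (∀ i, X (ι i) - corner c ∈ box ℓ) ∧
      (fun j : {j // j ∉ Set.range ι} => X j) ∈
        {Z : {j // j ∉ Set.range ι} → Space |
          ∀ (j : {j // j ∉ Set.range ι}) (c' : Fin M), lam j.1 = c'.castSucc →
            Z j - corner c' ∈ box ℓ}} =
      {X : Config N | ∀ j (c' : Fin M), lam j = c'.castSucc → X j - corner c' ∈ box ℓ} := by
  intro ι
  have hrange : ∀ j : Fin N, j ∈ Set.range ι ↔ lam j = c.castSucc := by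
    intro j
    change j ∈ Set.range ((Finset.univ.filter fun i => lam i = c.castSucc).orderEmbOfFin rfl) ↔ _
    rw [Finset.range_orderEmbOfFin]
    simp
  ext X
  simp only [Set.mem_setOf_eq, Subtype.forall]
  constructor
  · rintro ⟨h1, h2⟩ j c' hjc
    by_cases hj : j ∈ Set.range ι
    · obtain ⟨i, rfl⟩ := hj
      have : lam (ι i) = c.castSucc := (hrange _).1 (Set.mem_range_self i)
      rw [this] at hjc
      have hcc : c = c' := Fin.castSucc_injective _ hjc
      subst hcc
      exact h1 i
    · exact h2 j hj c' hjc
  · intro h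
    refine ⟨fun i => h (ι i) c ((hrange _).1 (Set.mem_range_self i)), fun j _ c' hjc => h j c' hjc⟩

/-- **The mixed Dirichlet/Neumann floor.**  Let `ψ` be `C¹` on `(ℝ³)^N`, `lam : Fin N → Fin (M+1)`
a labelling, `corner : Fin M → ℝ³` cell corners, `ℓ` a cell side and `L` a box side.  Suppose
`ψ` is symmetric under the permutations preserving `lam` and vanishes as soon as a particle of
the last ("bulk") label leaves `Λ_L`.  Then on the region
`R = {X | ∀ j c, lam j = c (< M) → X j - corner c ∈ Λ_ℓ}`,
`(E₀^D(#{lam = M}, L) + ∑_{c<M} E₀^Neu(#{lam = c}, ℓ)) · ∫_R |ψ|² ≤ ∫_R (|∇ψ|² + ∑ v |ψ|²)`.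
[cite: LSSY2005, (2.52)–(2.53)] -/
theorem mixed_floor_le_setLIntegral (lam : Fin N → Fin (M + 1)) (corner : Fin M → Space)
    (ℓ L : ℝ) {v : ℝ → ℝ≥0∞} (hv : Measurable v) {ψ : Config N → ℂ} (hψ : ContDiff ℝ 1 ψ)
    (hsymm : ∀ π : Equiv.Perm (Fin N), (∀ j, lam (π j) = lam j) → ∀ X, ψ (X ∘ π) = ψ X)
    (hsupp : ∀ X : Config N, (∃ j, lam j = Fin.last M ∧ X j ∉ box L) → ψ X = 0) :
    (groundStateEnergy v (Finset.univ.filter fun i => lam i = Fin.last M).card L +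
        ∑ c : Fin M, neumannGroundStateEnergy v
          (Finset.univ.filter fun i => lam i = c.castSucc).card ℓ) *
        ∫⁻ X in {X : Config N | ∀ j (c : Fin M), lam j = c.castSucc → X j - corner c ∈ box ℓ},
          (‖ψ X‖₊ : ℝ≥0∞) ^ 2 ≤
      ∫⁻ X in {X : Config N | ∀ j (c : Fin M), lam j = c.castSucc → X j - corner c ∈ box ℓ},
        kineticDensity ψ X + interaction v X * (‖ψ X‖₊ : ℝ≥0∞) ^ 2 := by
  set R := {X : Config N | ∀ j (c : Fin M), lam j = c.castSucc → X j - corner c ∈ box ℓ} with hR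
  -- the density of the group with label `c₀`
  set dens : Fin (M + 1) → Config N → ℝ≥0∞ := fun c₀ X =>
    kineticOn ((Finset.univ.filter fun i => lam i = c₀).orderEmbOfFin rfl) ψ X +
      interactionOn ((Finset.univ.filter fun i => lam i = c₀).orderEmbOfFin rfl) v X *
        (‖ψ X‖₊ : ℝ≥0∞) ^ 2 with hdens
  have hmeas : ∀ c₀, Measurable (dens c₀) := fun c₀ =>
    (measurable_kineticOn _ hψ).add ((measurable_interactionOn _ hv).mul
      (measurable_normSq hψ.continuous))
  -- the bulk group: Dirichlet floor
  have hbulk : groundStateEnergy v (Finset.univ.filter fun i => lam i = Fin.last M).card L *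
      ∫⁻ X in R, (‖ψ X‖₊ : ℝ≥0∞) ^ 2 ≤ ∫⁻ X in R, dens (Fin.last M) X := by
    set ι := ((Finset.univ.filter fun i => lam i = Fin.last M).orderEmbOfFin rfl).toEmbedding
      with hι
    have hrange : ∀ j : Fin N, j ∈ Set.range ι ↔ lam j = Fin.last M := by
      intro j
      change j ∈ Set.range ((Finset.univ.filter fun i => lam i = Fin.last M).orderEmbOfFin rfl) ↔ _
      rw [Finset.range_orderEmbOfFin]
      simp
    have h := groundStateEnergy_mul_le_setLIntegral_group ι 0 L hv hψ
      (fun τ X => hsymm _ (apply_extendDomain_eq_of_fiber lam (Fin.last M) τ) X)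
      (fun X ⟨i, hi⟩ => hsupp X ⟨ι i, (hrange _).1 (Set.mem_range_self i), by
        rwa [sub_zero] at hi⟩)
      {Z : {j // j ∉ Set.range ι} → Space |
        ∀ (j : {j // j ∉ Set.range ι}) (c : Fin M), lam j.1 = c.castSucc → Z j - corner c ∈ box ℓ}
    rw [setOf_bulk_eq_region lam corner ℓ] at h
    exact h
  -- the cell groups: Neumann floors
  have hcell : ∀ c : Fin M, neumannGroundStateEnergy v
      (Finset.univ.filter fun i => lam i = c.castSucc).card ℓ *
        ∫⁻ X in R, (‖ψ X‖₊ : ℝ≥0∞) ^ 2 ≤ ∫⁻ X in R, dens c.castSucc X := by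
    intro c
    have h := neumannGroundStateEnergy_mul_le_setLIntegral_group
      ((Finset.univ.filter fun i => lam i = c.castSucc).orderEmbOfFin rfl).toEmbedding
      (corner c) ℓ hv hψ
      {Z : {j // j ∉ Set.range ((Finset.univ.filter fun i =>
          lam i = c.castSucc).orderEmbOfFin rfl).toEmbedding} → Space |
        ∀ (j : {j // j ∉ Set.range ((Finset.univ.filter fun i =>
          lam i = c.castSucc).orderEmbOfFin rfl).toEmbedding}) (c' : Fin M),
          lam j.1 = c'.castSucc → Z j - corner c' ∈ box ℓ}
    rw [setOf_cell_eq_region lam corner ℓ c] at h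
    exact h
  -- summing the groups
  calc (groundStateEnergy v (Finset.univ.filter fun i => lam i = Fin.last M).card L +
        ∑ c : Fin M, neumannGroundStateEnergy v
          (Finset.univ.filter fun i => lam i = c.castSucc).card ℓ) *
        ∫⁻ X in R, (‖ψ X‖₊ : ℝ≥0∞) ^ 2
      = groundStateEnergy v (Finset.univ.filter fun i => lam i = Fin.last M).card L *
          (∫⁻ X in R, (‖ψ X‖₊ : ℝ≥0∞) ^ 2) +
        ∑ c : Fin M, neumannGroundStateEnergy v
          (Finset.univ.filter fun i => lam i = c.castSucc).card ℓ *
            ∫⁻ X in R, (‖ψ X‖₊ : ℝ≥0∞) ^ 2 := by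
        rw [add_mul, Finset.sum_mul]
    _ ≤ (∫⁻ X in R, dens (Fin.last M) X) + ∑ c : Fin M, ∫⁻ X in R, dens c.castSucc X :=
        add_le_add hbulk (Finset.sum_le_sum fun c _ => hcell c)
    _ = ∫⁻ X in R, ∑ c₀ : Fin (M + 1), dens c₀ X := by
        rw [lintegral_finsetSum Finset.univ fun c₀ _ => hmeas c₀, Fin.sum_univ_castSucc, add_comm]
    _ ≤ ∫⁻ X in R, kineticDensity ψ X + interaction v X * (‖ψ X‖₊ : ℝ≥0∞) ^ 2 := by
        refine lintegral_mono fun X => ?_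
        simp only [hdens]
        rw [Finset.sum_add_distrib, ← Finset.sum_mul, ← kineticDensity_eq_sum_kineticOn lam ψ X]
        gcongr
        exact sum_interactionOn_le_interaction lam v X

/-! ### The regions of the labellings with a fixed split partition the box -/

section Grid

variable {K : ℕ} {ℓ : ℝ}

/-- A point of `ℝ³` lies in at most one open grid cell. [cite: LSSY2005, (2.52)] -/
theorem cellIndex_unique (hℓ : 0 < ℓ) {x : Space} {c c' : Fin (K ^ 3)}
    (hc : x - cellCorner K ℓ c ∈ box ℓ) (hc' : x - cellCorner K ℓ c' ∈ box ℓ) : c = c' := by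
  by_contra hne
  have hdisj := pairwiseDisjoint_cellSet (N := 1) (M := K) hℓ
    (show (fun _ : Fin 1 => c) ≠ fun _ => c' from fun h => hne (congrFun h 0))
  rw [Function.onFun, Set.disjoint_left] at hdisj
  exact hdisj (a := fun _ => x) (fun _ => hc) (fun _ => hc')

/-- The regions of two different labellings inducing the same split are disjoint.
[cite: LSSY2005, (2.52)] -/
theorem disjoint_region_of_ne (hℓ : 0 < ℓ) {σ : Fin N → Fin 2}
    {lam lam' : Fin N → Fin (K ^ 3 + 1)} (hlam : ∀ j, lam j = Fin.last _ ↔ σ j = 0)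
    (hlam' : ∀ j, lam' j = Fin.last _ ↔ σ j = 0) (hne : lam ≠ lam') :
    Disjoint {X : Config N | ∀ j (c : Fin (K ^ 3)), lam j = c.castSucc →
        X j - cellCorner K ℓ c ∈ box ℓ}
      {X : Config N | ∀ j (c : Fin (K ^ 3)), lam' j = c.castSucc →
        X j - cellCorner K ℓ c ∈ box ℓ} := by
  rw [Set.disjoint_left]
  intro X hX hX'
  apply hne
  funext j
  by_cases hj : lam j = Fin.last _
  · rw [hj, ((hlam' j).2 ((hlam j).1 hj))]
  · have hj' : lam' j ≠ Fin.last _ := fun h => hj ((hlam j).2 ((hlam' j).1 h))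
    obtain ⟨c, hc⟩ := Fin.exists_castSucc_eq.2 hj
    obtain ⟨c', hc'⟩ := Fin.exists_castSucc_eq.2 hj'
    rw [← hc, ← hc', cellIndex_unique hℓ (hX j c hc.symm) (hX' j c' hc'.symm)]

/-- Off the grid hyperplanes, every configuration of the box `Λ_{Kℓ}^N` lies in the region of
some labelling inducing any prescribed split. [cite: LSSY2005, (2.52)] -/
theorem exists_region_of_mem_boxN (hℓ : 0 < ℓ) (hK : 0 < K) (σ : Fin N → Fin 2) {X : Config N}
    (hX : X ∈ boxN N (K * ℓ))
    (hgrid : X ∉ ⋃ i : Fin N, ⋃ k : Fin 3, ⋃ q : Fin (K + 1), {X : Config N | X i k = q * ℓ}) :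
    ∃ lam : Fin N → Fin (K ^ 3 + 1), (∀ j, lam j = Fin.last _ ↔ σ j = 0) ∧
      ∀ j (c : Fin (K ^ 3)), lam j = c.castSucc → X j - cellCorner K ℓ c ∈ box ℓ := by
  rcases boxN_subset_iUnion_cellSet_union hℓ hK hX with h | h
  · obtain ⟨τ, hτ⟩ := Set.mem_iUnion.1 h
    refine ⟨fun j => if σ j = 0 then Fin.last _ else (τ j).castSucc, fun j => ?_, fun j c hjc => ?_⟩
    · by_cases hj : σ j = 0
      · simp [hj]
      · simp only [hj, iff_false, if_false]
        exact (Fin.castSucc_lt_last _).ne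
    · dsimp only at hjc
      split_ifs at hjc with hj
      · exact absurd hjc (Fin.castSucc_lt_last c).ne'
      · rw [← Fin.castSucc_injective _ hjc]
        exact hτ j
  · exact absurd h hgrid

/-- **The regions of the labellings with a fixed split partition the box up to a null set**:
for `ℓ > 0`, `K > 0`, a split `σ : Fin N → Fin 2` and a measurable `F ≥ 0` vanishing off
`Λ_{Kℓ}^N`, `∫ F = ∑_{lam ↦ σ} ∫_{R(lam)} F`, the sum over the labellings `lam : Fin N → Fin (K³+1)`
with `lam j = K³ ↔ σ j = 0`, `R(lam) = {X | lam j = c < K³ → X j ∈ cellCorner c + Λ_ℓ}`.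
[cite: LSSY2005, (2.52)] -/
theorem lintegral_eq_sum_setLIntegral_fiber (hℓ : 0 < ℓ) (hK : 0 < K) (σ : Fin N → Fin 2)
    {F : Config N → ℝ≥0∞} (hF0 : ∀ X, X ∉ boxN N (K * ℓ) → F X = 0) :
    ∫⁻ X, F X = ∑ lam ∈ Finset.univ.filter
        (fun lam : Fin N → Fin (K ^ 3 + 1) => ∀ j, lam j = Fin.last _ ↔ σ j = 0),
      ∫⁻ X in {X : Config N | ∀ j (c : Fin (K ^ 3)), lam j = c.castSucc →
        X j - cellCorner K ℓ c ∈ box ℓ}, F X := by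
  classical
  set Sfib := Finset.univ.filter
    (fun lam : Fin N → Fin (K ^ 3 + 1) => ∀ j, lam j = Fin.last _ ↔ σ j = 0) with hSfib
  set R : (Fin N → Fin (K ^ 3 + 1)) → Set (Config N) := fun lam =>
    {X : Config N | ∀ j (c : Fin (K ^ 3)), lam j = c.castSucc → X j - cellCorner K ℓ c ∈ box ℓ}
    with hRdef
  have hRm : ∀ lam, MeasurableSet (R lam) := by
    intro lam
    have : R lam = ⋂ j, ⋂ c : Fin (K ^ 3), ⋂ (_ : lam j = c.castSucc),
        (fun X : Config N => X j - cellCorner K ℓ c) ⁻¹' box ℓ := by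
      ext X; simp [hRdef]
    rw [this]
    exact MeasurableSet.iInter fun j => MeasurableSet.iInter fun c =>
      MeasurableSet.iInter fun _ =>
        (measurableSet_box ℓ).preimage ((measurable_config_apply j).sub_const _)
  set U := ⋃ lam ∈ Sfib, R lam with hU
  have hUm : MeasurableSet U := MeasurableSet.biUnion (Set.to_countable _) fun lam _ => hRm lam
  -- the complement of `U` carries no mass of `F`
  set G := ⋃ i : Fin N, ⋃ k : Fin 3, ⋃ q : Fin (K + 1), {X : Config N | X i k = q * ℓ} with hG
  have hG0 : volume G = 0 :=
    measure_iUnion_null_iff.2 fun i => measure_iUnion_null_iff.2 fun k =>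
      measure_iUnion_null_iff.2 fun q : Fin (K + 1) =>
        volume_setOf_apply_eq_const N i k (((q : ℕ) : ℝ) * ℓ)
  have hcompl : ∫⁻ X in Uᶜ, F X = 0 := by
    have hsub : Uᶜ ⊆ G ∪ (boxN N (K * ℓ))ᶜ := by
      intro X hX
      by_cases hb : X ∈ boxN N (K * ℓ)
      · left
        by_contra hg
        obtain ⟨lam, hlam, hXlam⟩ := exists_region_of_mem_boxN hℓ hK σ hb hg
        exact hX (Set.mem_biUnion (Finset.mem_filter.2 ⟨Finset.mem_univ _, hlam⟩) hXlam)
      · exact Or.inr hb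
    have hle : ∫⁻ X in Uᶜ, F X ≤ (∫⁻ X in G, F X) + ∫⁻ X in (boxN N (K * ℓ))ᶜ, F X :=
      (lintegral_mono_set hsub).trans (lintegral_union_le _ _ _)
    have h1 : ∫⁻ X in G, F X = 0 := setLIntegral_measure_zero G _ hG0
    have h2 : ∫⁻ X in (boxN N (K * ℓ))ᶜ, F X = 0 :=
      setLIntegral_eq_zero (measurableSet_boxN N _).compl fun X hX => hF0 X hX
    rw [h1, h2, add_zero] at hle
    exact le_antisymm hle bot_le
  have hsplit : ∫⁻ X, F X = ∫⁻ X in U, F X := by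
    rw [← lintegral_add_compl F hUm, hcompl, add_zero]
  rw [hsplit, hU, lintegral_biUnion_finset (fun lam hlam lam' hlam' hne =>
    disjoint_region_of_ne (σ := σ) hℓ (Finset.mem_filter.1 hlam).2 (Finset.mem_filter.1 hlam').2 hne)
    fun lam _ => hRm lam]

end Grid

end Literature.MathematicalPhysics.QuantumManyBody.BoseGas

end
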